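/-
Copyright (c) 2026 the pub-hodgecm-mathlib formalisation cell (harness21).  Prover seat hodgecm-mathlib-K2E2-p12 (g10), Track B «K2-LIT», h413 = `stmt-HodgeConjecture-24833`,
route `HCCMUnconditional`; R90-TF section S8 «ContSpec-n½», deal S8-R228 (1) (S8 dealer R90-CS-plan (g3)): the ℓ-CT ∕ scattering SCALAR LETTERS under which the Maass–Selberg road
(★ p864107 ∕ p864145 ∕ p864494, this lineage) pays (MS-P′) = `hMSP′` at the NAMED witness family — (L2) OF RECORD letter-free, the regular data from ONE coordinate-analyticity letter and
ONE axis-reality letter, both GLOBAL and about NAMED objects (census `R90/S8/CENSUS-OnAxisScalars.K2E2-p12-g10.md` a45921dec8e9d2bf).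
-/
import Summits.HodgeConjecture.HodgeConjecture.Theorems.K2E1ChiTruncatedFamilyTransportCMThree          -- ★ p864608 (this seat): `hE6_midWitness` ((E6) at the named family, global); brings ★ `midWitnessExports_spec`, ★ `one_apply_torus`, `isAutomorphic_one`
import Summits.HodgeConjecture.HodgeConjecture.Theorems.K2E1ChiMaassSelbergPoleExclusionOffAxisCMThree   -- ★ p864494 (this seat): `hMSP_of_exports_free_at` (the Maass–Selberg bound at EVERY regular point, `1 < Re`)
import Summits.HodgeConjecture.HodgeConjecture.Theorems.R90S8ResGMidBlockScatteringOfRecordU3          -- ★ (K2E1-p13): `integrable_restrict_mul_conj_of_bounded`; brings ★ p16 part-2a `K2E1ChiScatteringPairingsContinuedCMThree` (`differentiableOn_wc`, `wc_agree`, `Bc_agree`, …)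
import HarnessLib

/-!
# h413 ∕ R90-S8 — `K2E1ChiMaassSelbergOnAxisScalarsOfRecordCMThree`: THE SCALAR LETTERS OF (MS-P′) AT THE NAMED WITNESS FAMILY — (L2) OF RECORD (letter-free), the regular data from
# coordinate analyticity, and `hMSP′` BYTE FOR BYTE modulo two NAMED GLOBAL letters (`hqa`: the coordinates are analytic at the candidates off `3∕2`; `hreal`: axis reality)

Cell `pub/hodgecm-mathlib`, crux H413 = `stmt-HodgeConjecture-24833`, route `HCCMUnconditional`; R90-TF section S8, deal S8-R228 (1); (V) LEDGER 5e21725b4bac9bd5 row 3 (`hMSP′`).  THEOREMS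
ONLY (no `def`, no `instance`, no notation, no named-fact hypothesis, no `sorry`; default heartbeats); lane `--supports stmt-HodgeConjecture-24833 --as helper` (count-neutral).  Closes no socket.

THE MATHEMATICS ([MoeglinWaldspurger1995, IV.1.10–IV.1.11, IV.2.3, IV.3.12 (a)]; [BernsteinLapid2019, §4 p. 10]; [Rogawski1990, §13.9]).  ★ `hMSP_of_exports_free_at` bounds an (E6) family near
ANY `z₀` with `1 < Re z₀` from (L2) — continued scalars `wc`, `Bc` holomorphic off the pole set with their tube agreements — and (L3′) — `wc` analytic at `z₀`, real on the punctured real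
trace if `z₀` is real, `Bc z z` bounded near `z₀`.  At the NAMED witness family (★ p864008 `midWitnessQ ∕ midWitnessEc ∕ midWitnessQc ∕ midWitnessP`) and its ★ (E6) family (★ p864608
`hE6_midWitness`): (L2) is LETTER-FREE — the scalars are the finite sums `wc s = (Σ_j qc_j(s)·⟨φ′_j, φ⟩_K)·[η]`, `Bc s s′ = κ·Σ_{j,l} qc_j(s)·conj qc_l(s′)·⟨φ′_j, φ′_l⟩_K` over the continued
coordinates `qc_j := midWitnessQc j` (holomorphic off `midWitnessP`, equal to the tube coordinates there: spec clauses 13, 6) on the basis `φ′_j := bV j`, the tube agreements being the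
coordinate identity (clause 2, `ν 𝓕 = 1`) through ★ p16's part-2a bookkeeping — exactly ★ p13 `exists_hSCAT_of_coords`' composition, re-run WITHOUT its `3∕2` pole data and GLOBALLY off
`P` (§1).  At a candidate `z₀ ∈ P`, `1 < Re z₀`, `z₀ ≠ 3∕2`, the regular data `hwa`, `hβB` then follow from ONE letter, the analyticity of the coordinates at `z₀` (§2: finite sums; `z ↦ Bc z z`
continuous); what remains is NAMED and GLOBAL (§3): **`hqa`** — «the scattering coordinates are holomorphic on `{1 < Re} ∖ {3∕2}`» (Euler route on the half-plane: the partial Hecke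
`L`-ratio's only pole there is `3∕2`, denominators non-vanishing on `Re > 1` by the Euler product, normalised local intertwiners holomorphic [MW95 IV.1.10–11; Rogawski §13.9] — in the tree at
`3∕2` only: ★ F5, p11's `hr hfacv`), and **`hreal`** — «`wc` is real on the real axis off the poles» (the adjoint functional equation `M(s̄)* = M(s)` for self-associate `χ` [MW95 IV.1.10];
void when the bracket `[η] = ∫ ‖x‖·χʷ conj χ` vanishes, §3 corollary).
* §1 **`exists_scalars_of_coords_global`** (generic exports tuple `(q, qc, P)` on a scattering family `φ′`): (L2) in ★ p864494's binder BYTES at `Pᶜ` + the closed formulas of `wc`, `Bc`.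
* §2 `analyticAt_of_coords_formula`, `continuousAt_kernelDiag_of_coords`, `exists_eventually_norm_le_of_continuousAt`, `exists_eventually_norm_kernelDiag_le_of_coords`,
  `eventually_im_eq_zero_of_real_offPoles` — (L3′) from coordinate analyticity ∕ the global axis letter.
* §3 HEAD **`hMSP'_midWitness_of_coordLetters`** — the `hMSP′` binder of ★ `ledgerLetters_of_exports` ∕ (V) OF RECORD BYTE FOR BYTE from the spec's binders, the Maass–Selberg frame extras
  (`μK νI 𝓕I h𝓕I`, `h𝓕1`, `hχ₁ hρ₁`) and the two letters; **`hMSP'_midWitness_of_coordLetters_of_bracket_eq_zero`** — non-self-associate blocks: `hreal` replaced by `[η] = 0`.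
HONEST LABEL: HC_CM is proved only modulo the 7 printed citations (2 remaining named inputs: hLiu418 = `stmt-HodgeConjecture-24832`, h413 = `stmt-HodgeConjecture-24833`) until rung 0
closes; this file asserts no named fact and closes no socket; `hMSP′` becomes ★ MODULO the two named letters `hqa` (scalar half on the half-plane, L−∕T) and `hreal` (self-associate, L−); count-neutral.

## References
* [MoeglinWaldspurger1995] C. Mœglin, J.-L. Waldspurger, *Spectral Decomposition and Eisenstein Series* (1995), IV.1.10–IV.1.11, IV.2.3, IV.3.12 (a).
* [BernsteinLapid2019] J. Bernstein, E. Lapid, *On the meromorphic continuation of Eisenstein series*, J. AMS 37 (2024), §4 (p. 10).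
* [Rogawski1990] J. D. Rogawski, *Automorphic Representations of Unitary Groups in Three Variables* (1990), §13.9 (p. 229).
-/

set_option autoImplicit false
set_option linter.dupNamespace false  -- the mandated namespace repeats the summit's segment (`HodgeConjecture.HodgeConjecture`)

noncomputable section

open MeasureTheory Measure NumberField IsDedekindDomain Set Filter Topology
open scoped ENNReal NNReal ComplexConjugate
open Literature.MeasureTheory.Group Literature.NumberTheory Literature.NumberTheory.Automorphic Literature.NumberTheory.Automorphic.UnitaryGroup Literature.NumberTheory.GaloisRepresentations AdelicGroupData
open Literature.NumberTheory.Automorphic.Arthur2013.Leaves.TECR Literature.NumberTheory.Rogawski1990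
open Summit.HodgeConjecture.HodgeConjecture.Cruxes.H413.K2E1BorelEisensteinU Summit.HodgeConjecture.HodgeConjecture.Cruxes.H413.K2E1CharacterEisensteinU2Defs
open Summit.HodgeConjecture.HodgeConjecture.Cruxes.H413.K2E1CharacterEisensteinU3PairDefs Summit.HodgeConjecture.HodgeConjecture.Cruxes.H413.K2E1BLBorelSpacesU2Defs
open Summit.HodgeConjecture.HodgeConjecture.Cruxes.H413.K2E1ChiSectionSpaceU2Defs (chiSectionSpace isChiSection_of_mem)
open Summit.HodgeConjecture.HodgeConjecture.Cruxes.H413.K2E1ChiScatteringPairingsContinuedCMThree (wc_eq_mul_bracket differentiableOn_wc wc_agree differentiableOn_Bc_fst differentiableOn_Bc_snd_conj Bc_agree)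
open Summit.HodgeConjecture.HodgeConjecture.Cruxes.H413.R90S8ResGMidBlockScatteringOfRecordU3 (integrable_restrict_mul_conj_of_bounded)
open Summit.HodgeConjecture.HodgeConjecture.Cruxes.H413.K2E1ChiMaassSelbergPoleExclusionOffAxisCMThree (hMSP_of_exports_free_at)
open Summit.HodgeConjecture.HodgeConjecture.Cruxes.H413.K2E1ChiTruncatedFamilyTransportCMThree (hE6_midWitness)
open Summit.HodgeConjecture.HodgeConjecture.Cruxes.H413.K2E1ChiEisensteinMeromorphicExportsM1CMThree (one_apply_torus isAutomorphic_one)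
open Summit.HodgeConjecture.HodgeConjecture.R90.S8 (midWitnessEc midWitnessP midWitnessQc midWitnessQ midWitnessExports_spec)

namespace Summit.HodgeConjecture.HodgeConjecture.Cruxes.H413.K2E1ChiMaassSelbergOnAxisScalarsOfRecordCMThree

/-! ## §1 (L2) GLOBALLY OFF THE POLE SET from the continued coordinates, with the closed formulas (★ `exists_hSCAT_of_coords` §1 without the `3∕2` pole data) -/

section Coords

variable (L : Type) [Field L] [NumberField L] [IsCMField L]
variable [MeasurableSpace (quasiSplit (↥(maximalRealSubfield L)) L (IsCMField.complexConj L) 3).Adelic]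
variable [MeasurableSpace (AdeleRing (𝓞 L) L)ˣ]

/-- **(L2) OF ★ `hMSP_of_exports_free_at`, GLOBALLY OFF `P`, FROM THE CONTINUED COORDINATES — WITH THE CLOSED FORMULAS** (★ `exists_hSCAT_of_coords` §1 re-run at `D₁ = D₂ := Pᶜ`
without its `3∕2` pole data): given a scattering family `φ′_j` with tube coordinates `Σ_j q_j(z)•φ′_j = (ν𝓕)⁻¹•φ̃_z` on `{2 < Re}` (`ν 𝓕 = 1`), continued coordinates `qc_j` holomorphic off
the CLOSED `P` with `qc_j = q_j` on the tube, and integrable Gram pairings on `K`, the definition-free scalars `wc s := ∫ ‖x‖·(η(x)·Σ_j qc_j(s)·⟨φ′_j, φ⟩_K)`,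
`Bc s s′ := κ·Σ_{j,l} qc_j(s)·conj qc_l(s′)·G_{jl}` satisfy: `wc` holomorphic on `Pᶜ`, its tube agreement, `s ↦ Bc s s′` holomorphic on `Pᶜ`, `u ↦ Bc s (conj u)` holomorphic on
`conj⁻¹Pᶜ`, the tube agreement of `Bc` — the five (L2) binders of ★ p864494 IN ITS BYTES — and the closed formulas of `wc` and `Bc` (★ part-2a `differentiableOn_wc`, `wc_agree`,
`differentiableOn_Bc_fst`, `differentiableOn_Bc_snd_conj`, `Bc_agree`). [cite: BernsteinLapid2019, §4 p. 10] [cite: MoeglinWaldspurger1995, IV.1.11, IV.2.3] -/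
theorem exists_scalars_of_coords_global
    (μK : Measure ((standardMaximalCompactGL 3 L).comap (adelicVal (↥(maximalRealSubfield L)) L (IsCMField.complexConj L) 3 ((StdForm.antidiagonal 3).over L)) : Subgroup (quasiSplit (↥(maximalRealSubfield L)) L (IsCMField.complexConj L) 3).Adelic))
    (νI : Measure (AdeleRing (𝓞 L) L)ˣ) (𝓕I : Set (AdeleRing (𝓞 L) L)ˣ)
    (ν : Measure ↥(adelicUnipotent (↥(maximalRealSubfield L)) L (IsCMField.complexConj L) 3))
    {𝓕 : Set ↥(adelicUnipotent (↥(maximalRealSubfield L)) L (IsCMField.complexConj L) 3)} (h𝓕1 : ν 𝓕 = 1)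
    (χ₁ : HeckeCharacter L) (φ : (quasiSplit (↥(maximalRealSubfield L)) L (IsCMField.complexConj L) 3).Adelic → ℂ)
    {ι : Type} [Fintype ι] (φ' : ι → (quasiSplit (↥(maximalRealSubfield L)) L (IsCMField.complexConj L) 3).Adelic → ℂ) {q qc : ι → ℂ → ℂ} {P : Set ℂ}
    (hqφ : ∀ z : ℂ, 2 < z.re → (∑ j, q j z • φ' j) = ((((ν 𝓕).toReal⁻¹ : ℝ)) : ℂ) • (fun g : (quasiSplit (↥(maximalRealSubfield L)) L (IsCMField.complexConj L) 3).Adelic => (∫ v : ↥(adelicUnipotent (↥(maximalRealSubfield L)) L (IsCMField.complexConj L) 3), flatSectionU φ z ((quasiSplit (↥(maximalRealSubfield L)) L (IsCMField.complexConj L) 3).toAdelic (weylLongU ((IsCMField.complexConj L : L ≃ₐ[↥(maximalRealSubfield L)] L) : L →+* L) (rfl : (StdForm.antidiagonal 3).over L = (StdForm.antidiagonal 3).over L)) * ((v : (quasiSplit (↥(maximalRealSubfield L)) L (IsCMField.complexConj L) 3).Adelic) * g)) ∂ν) * (((borelHeight g : ℝ) : ℂ) ^ (z - 2))))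
    (hqcP : ∀ j, DifferentiableOn ℂ (qc j) Pᶜ) (hqcq : ∀ j (z : ℂ), 2 < z.re → qc j z = q j z) (hPc : IsClosed P)
    (hint : ∀ j, Integrable (fun k : ((standardMaximalCompactGL 3 L).comap (adelicVal (↥(maximalRealSubfield L)) L (IsCMField.complexConj L) 3 ((StdForm.antidiagonal 3).over L)) : Subgroup (quasiSplit (↥(maximalRealSubfield L)) L (IsCMField.complexConj L) 3).Adelic) => φ' j (k : (quasiSplit (↥(maximalRealSubfield L)) L (IsCMField.complexConj L) 3).Adelic) * conj (φ (k : (quasiSplit (↥(maximalRealSubfield L)) L (IsCMField.complexConj L) 3).Adelic))) μK)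
    (hbb : ∀ j l, Integrable (fun k : ((standardMaximalCompactGL 3 L).comap (adelicVal (↥(maximalRealSubfield L)) L (IsCMField.complexConj L) 3 ((StdForm.antidiagonal 3).over L)) : Subgroup (quasiSplit (↥(maximalRealSubfield L)) L (IsCMField.complexConj L) 3).Adelic) => φ' j (k : (quasiSplit (↥(maximalRealSubfield L)) L (IsCMField.complexConj L) 3).Adelic) * conj (φ' l (k : (quasiSplit (↥(maximalRealSubfield L)) L (IsCMField.complexConj L) 3).Adelic))) μK) :
    ∃ (wc : ℂ → ℂ) (Bc : ℂ → ℂ → ℂ),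
      DifferentiableOn ℂ wc Pᶜ ∧
      (∀ s : ℂ, 2 < s.re → wc s = ∫ x in {x : (AdeleRing (𝓞 L) L)ˣ | (IdeleClassGroup.ideleNorm L x : ℝ) ≤ 1} ∩ 𝓕I, ((IdeleClassGroup.ideleNorm L x : ℝ) : ℂ) * (((reflectChar (IsCMField.complexConj L) χ₁ x : ℂˣ) : ℂ) * conj ((χ₁ x : ℂˣ) : ℂ) * (∫ k, (fun g : (quasiSplit (↥(maximalRealSubfield L)) L (IsCMField.complexConj L) 3).Adelic => (∫ v : ↥(adelicUnipotent (↥(maximalRealSubfield L)) L (IsCMField.complexConj L) 3), flatSectionU φ s ((quasiSplit (↥(maximalRealSubfield L)) L (IsCMField.complexConj L) 3).toAdelic (weylLongU ((IsCMField.complexConj L : L ≃ₐ[↥(maximalRealSubfield L)] L) : L →+* L) (rfl : (StdForm.antidiagonal 3).over L = (StdForm.antidiagonal 3).over L)) * ((v : (quasiSplit (↥(maximalRealSubfield L)) L (IsCMField.complexConj L) 3).Adelic) * g)) ∂ν) * ((borelHeight g : ℝ) : ℂ) ^ (s - 2)) (k : (quasiSplit (↥(maximalRealSubfield L)) L (IsCMField.complexConj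 L) 3).Adelic) * conj (φ (k : (quasiSplit (↥(maximalRealSubfield L)) L (IsCMField.complexConj L) 3).Adelic)) ∂μK)) ∂νI) ∧
      (∀ z' : ℂ, DifferentiableOn ℂ (fun z : ℂ => Bc z z') Pᶜ) ∧ (∀ z : ℂ, DifferentiableOn ℂ (fun u : ℂ => Bc z (conj u)) {u : ℂ | conj u ∉ P}) ∧
      (∀ s s' : ℂ, 2 < s.re → 2 < s'.re → Bc s s' = (∫ x in {x : (AdeleRing (𝓞 L) L)ˣ | (IdeleClassGroup.ideleNorm L x : ℝ) ≤ 1} ∩ 𝓕I, ((IdeleClassGroup.ideleNorm L x : ℝ) : ℂ) ∂νI) * (∫ k, (fun g : (quasiSplit (↥(maximalRealSubfield L)) L (IsCMField.complexConj L) 3).Adelic => (∫ v : ↥(adelicUnipotent (↥(maximalRealSubfield L)) L (IsCMField.complexConj L) 3), flatSectionU φ s ((quasiSplit (↥(maximalRealSubfield L)) L (IsCMField.complexConj L) 3).toAdelic (weylLongU ((IsCMField.complexConj L : L ≃ₐ[↥(maximalRealSubfield L)] L) : L →+* L) (rfl : (StdForm.antidiagonal 3).over L = (StdForm.antidiagonal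 3).over L)) * ((v : (quasiSplit (↥(maximalRealSubfield L)) L (IsCMField.complexConj L) 3).Adelic) * g)) ∂ν) * ((borelHeight g : ℝ) : ℂ) ^ (s - 2)) (k : (quasiSplit (↥(maximalRealSubfield L)) L (IsCMField.complexConj L) 3).Adelic) * conj ((fun g : (quasiSplit (↥(maximalRealSubfield L)) L (IsCMField.complexConj L) 3).Adelic => (∫ v : ↥(adelicUnipotent (↥(maximalRealSubfield L)) L (IsCMField.complexConj L) 3), flatSectionU φ s' ((quasiSplit (↥(maximalRealSubfield L)) L (IsCMField.complexConj L) 3).toAdelic (weylLongU ((IsCMField.complexConj L : L ≃ₐ[↥(maximalRealSubfield L)] L) : L →+* L) (rfl : (StdForm.antidiagonal 3).over L = (StdForm.antidiagonal 3).over L)) * ((v : (quasiSplit (↥(maximalRealSubfield L)) L (IsCMField.complexConj L) 3).Adelic) * g)) ∂ν) * ((borelHeight g : ℝ) : ℂ) ^ (s' - 2)) (k : (quasiSplit (↥(maximalRealSubfield L)) L (IsCMField.complexConj L) 3).Adelic)) ∂μK)) ∧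
      (∀ z : ℂ, wc z = (∑ j, qc j z * ∫ k, φ' j (k : (quasiSplit (↥(maximalRealSubfield L)) L (IsCMField.complexConj L) 3).Adelic) * conj (φ (k : (quasiSplit (↥(maximalRealSubfield L)) L (IsCMField.complexConj L) 3).Adelic)) ∂μK) *
        ∫ x in {x : (AdeleRing (𝓞 L) L)ˣ | (IdeleClassGroup.ideleNorm L x : ℝ) ≤ 1} ∩ 𝓕I, ((IdeleClassGroup.ideleNorm L x : ℝ) : ℂ) * (((reflectChar (IsCMField.complexConj L) χ₁ x : ℂˣ) : ℂ) * conj ((χ₁ x : ℂˣ) : ℂ)) ∂νI) ∧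
      (∀ s s' : ℂ, Bc s s' = (∫ x in {x : (AdeleRing (𝓞 L) L)ˣ | (IdeleClassGroup.ideleNorm L x : ℝ) ≤ 1} ∩ 𝓕I, ((IdeleClassGroup.ideleNorm L x : ℝ) : ℂ) ∂νI) *
        ∑ j, ∑ l, qc j s * conj (qc l s') * ∫ k, φ' j (k : (quasiSplit (↥(maximalRealSubfield L)) L (IsCMField.complexConj L) 3).Adelic) * conj (φ' l (k : (quasiSplit (↥(maximalRealSubfield L)) L (IsCMField.complexConj L) 3).Adelic)) ∂μK) := by
  -- the coordinate identity restricted to `K` (`ν 𝓕 = 1` kills the normalising factor)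
  have hqK : ∀ z ∈ {z : ℂ | 2 < z.re}, (∑ j, q j z • fun k : ((standardMaximalCompactGL 3 L).comap (adelicVal (↥(maximalRealSubfield L)) L (IsCMField.complexConj L) 3 ((StdForm.antidiagonal 3).over L)) : Subgroup (quasiSplit (↥(maximalRealSubfield L)) L (IsCMField.complexConj L) 3).Adelic) => φ' j (k : (quasiSplit (↥(maximalRealSubfield L)) L (IsCMField.complexConj L) 3).Adelic)) =
      fun k : ((standardMaximalCompactGL 3 L).comap (adelicVal (↥(maximalRealSubfield L)) L (IsCMField.complexConj L) 3 ((StdForm.antidiagonal 3).over L)) : Subgroup (quasiSplit (↥(maximalRealSubfield L)) L (IsCMField.complexConj L) 3).Adelic) => (fun g : (quasiSplit (↥(maximalRealSubfield L)) L (IsCMField.complexConj L) 3).Adelic => (∫ v : ↥(adelicUnipotent (↥(maximalRealSubfield L)) L (IsCMField.complexConj L) 3), flatSectionU φ z ((quasiSplit (↥(maximalRealSubfield L)) L (IsCMField.complexConj L) 3).toAdelic (weylLongU ((IsCMField.complexConj L : L ≃ₐ[↥(maximalRealSubfield L)] L) : L →+* L) (rfl : (StdForm.antidiagonal 3).over L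 = (StdForm.antidiagonal 3).over L)) * ((v : (quasiSplit (↥(maximalRealSubfield L)) L (IsCMField.complexConj L) 3).Adelic) * g)) ∂ν) * (((borelHeight g : ℝ) : ℂ) ^ (z - 2))) (k : (quasiSplit (↥(maximalRealSubfield L)) L (IsCMField.complexConj L) 3).Adelic) := by
    intro z hz
    funext k
    have h := congrFun (hqφ z hz) (k : (quasiSplit (↥(maximalRealSubfield L)) L (IsCMField.complexConj L) 3).Adelic)
    rw [h𝓕1, ENNReal.toReal_one, inv_one, Complex.ofReal_one, one_smul] at h
    rw [Finset.sum_apply] at h ⊢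
    simpa only [Pi.smul_apply, smul_eq_mul] using h
  have hqagree : ∀ j, ∀ z ∈ {z : ℂ | 2 < z.re}, qc j z = q j z := fun j z hz => hqcq j z hz
  -- the closed formula of the candidate `wc` (★ `wc_eq_mul_bracket`)
  have hwc' : ∀ z : ℂ, (∫ x in {x : (AdeleRing (𝓞 L) L)ˣ | (IdeleClassGroup.ideleNorm L x : ℝ) ≤ 1} ∩ 𝓕I, ((IdeleClassGroup.ideleNorm L x : ℝ) : ℂ) *
      ((((reflectChar (IsCMField.complexConj L) χ₁ x : ℂˣ) : ℂ) * conj ((χ₁ x : ℂˣ) : ℂ)) * ∑ j, qc j z * ∫ k, φ' j (k : (quasiSplit (↥(maximalRealSubfield L)) L (IsCMField.complexConj L) 3).Adelic) * conj (φ (k : (quasiSplit (↥(maximalRealSubfield L)) L (IsCMField.complexConj L) 3).Adelic)) ∂μK) ∂νI) =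
      (∑ j, qc j z * ∫ k, φ' j (k : (quasiSplit (↥(maximalRealSubfield L)) L (IsCMField.complexConj L) 3).Adelic) * conj (φ (k : (quasiSplit (↥(maximalRealSubfield L)) L (IsCMField.complexConj L) 3).Adelic)) ∂μK) *
        ∫ x in {x : (AdeleRing (𝓞 L) L)ˣ | (IdeleClassGroup.ideleNorm L x : ℝ) ≤ 1} ∩ 𝓕I, ((IdeleClassGroup.ideleNorm L x : ℝ) : ℂ) * (((reflectChar (IsCMField.complexConj L) χ₁ x : ℂˣ) : ℂ) * conj ((χ₁ x : ℂˣ) : ℂ)) ∂νI := fun z =>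
    wc_eq_mul_bracket νI ({x : (AdeleRing (𝓞 L) L)ˣ | (IdeleClassGroup.ideleNorm L x : ℝ) ≤ 1} ∩ 𝓕I) (fun x => ((IdeleClassGroup.ideleNorm L x : ℝ) : ℂ))
      (fun x => (((reflectChar (IsCMField.complexConj L) χ₁ x : ℂˣ) : ℂ) * conj ((χ₁ x : ℂˣ) : ℂ))) (fun j => ∫ k, φ' j (k : (quasiSplit (↥(maximalRealSubfield L)) L (IsCMField.complexConj L) 3).Adelic) * conj (φ (k : (quasiSplit (↥(maximalRealSubfield L)) L (IsCMField.complexConj L) 3).Adelic)) ∂μK) z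
  refine ⟨fun s => ∫ x in {x : (AdeleRing (𝓞 L) L)ˣ | (IdeleClassGroup.ideleNorm L x : ℝ) ≤ 1} ∩ 𝓕I, ((IdeleClassGroup.ideleNorm L x : ℝ) : ℂ) *
      ((((reflectChar (IsCMField.complexConj L) χ₁ x : ℂˣ) : ℂ) * conj ((χ₁ x : ℂˣ) : ℂ)) * ∑ j, qc j s * ∫ k, φ' j (k : (quasiSplit (↥(maximalRealSubfield L)) L (IsCMField.complexConj L) 3).Adelic) * conj (φ (k : (quasiSplit (↥(maximalRealSubfield L)) L (IsCMField.complexConj L) 3).Adelic)) ∂μK) ∂νI,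
    fun s s' => (∫ x in {x : (AdeleRing (𝓞 L) L)ˣ | (IdeleClassGroup.ideleNorm L x : ℝ) ≤ 1} ∩ 𝓕I, ((IdeleClassGroup.ideleNorm L x : ℝ) : ℂ) ∂νI) *
      ∑ j, ∑ l, qc j s * conj (qc l s') * ∫ k, φ' j (k : (quasiSplit (↥(maximalRealSubfield L)) L (IsCMField.complexConj L) 3).Adelic) * conj (φ' l (k : (quasiSplit (↥(maximalRealSubfield L)) L (IsCMField.complexConj L) 3).Adelic)) ∂μK, ?_, ?_, ?_, ?_, ?_, hwc', fun s s' => rfl⟩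
  · -- (L2) `hwc`
    exact differentiableOn_wc μK νI _ _ _ hqcP (fun k : ((standardMaximalCompactGL 3 L).comap (adelicVal (↥(maximalRealSubfield L)) L (IsCMField.complexConj L) 3 ((StdForm.antidiagonal 3).over L)) : Subgroup (quasiSplit (↥(maximalRealSubfield L)) L (IsCMField.complexConj L) 3).Adelic) => φ (k : (quasiSplit (↥(maximalRealSubfield L)) L (IsCMField.complexConj L) 3).Adelic))
  · -- (L2) `hwagree`
    intro s hs
    exact wc_agree μK νI _ _ _ hqK hqagree hint hs
  · -- (L2) `hBc1`
    intro z'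
    exact differentiableOn_Bc_fst hqcP _ _ z'
  · -- (L2) `hBc2`
    intro z
    exact differentiableOn_Bc_snd_conj hPc.isOpen_compl hqcP _ _ z
  · -- (L2) `hBagree`
    intro s s' hs hs'
    exact Bc_agree μK hqK hqagree hbb _ hs hs'

end Coords

/-! ## §2 (L3′) from coordinate analyticity and from the global axis letter -/

section Regular

variable {ι : Type} [Fintype ι]

/-- **`wc` IS ANALYTIC AT `z₀` WHEN THE COORDINATES ARE** (closed formula `wc z = (Σ_j qc_j(z)·G_j)·c`). [cite: BernsteinLapid2019, §4 p. 10] -/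
theorem analyticAt_of_coords_formula {qc : ι → ℂ → ℂ} {z₀ : ℂ} (hqa : ∀ j, AnalyticAt ℂ (qc j) z₀) (G : ι → ℂ) (c : ℂ) {wc : ℂ → ℂ}
    (hwc : ∀ z : ℂ, wc z = (∑ j, qc j z * G j) * c) : AnalyticAt ℂ wc z₀ := by
  rw [show wc = fun z => (∑ j, qc j z * G j) * c from funext hwc]
  exact (Finset.analyticAt_fun_sum Finset.univ fun j _ => (hqa j).mul analyticAt_const).mul analyticAt_const

/-- **THE DIAGONAL KERNEL `z ↦ κ·Σ_{j,l} qc_j(z)·conj qc_l(z)·G_{jl}` IS CONTINUOUS AT `z₀` WHEN THE COORDINATES ARE ANALYTIC THERE.** [folklore] -/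
theorem continuousAt_kernelDiag_of_coords {qc : ι → ℂ → ℂ} {z₀ : ℂ} (hqa : ∀ j, AnalyticAt ℂ (qc j) z₀) (κ : ℂ) (G : ι → ι → ℂ) :
    ContinuousAt (fun z : ℂ => κ * ∑ j, ∑ l, qc j z * conj (qc l z) * G j l) z₀ := by
  have hc : ∀ j, ContinuousAt (qc j) z₀ := fun j => (hqa j).continuousAt
  have hcc : ∀ l, ContinuousAt (fun z => conj (qc l z)) z₀ := fun l => Complex.continuous_conj.continuousAt.comp (hc l)
  exact continuousAt_const.mul (tendsto_finsetSum _ fun j _ => tendsto_finsetSum _ fun l _ => ((hc j).mul (hcc l)).mul continuousAt_const)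

/-- A function continuous at `z₀` is bounded on a punctured neighbourhood of `z₀`. [folklore] -/
theorem exists_eventually_norm_le_of_continuousAt {f : ℂ → ℂ} {z₀ : ℂ} (hf : ContinuousAt f z₀) : ∃ B : ℝ, ∀ᶠ z in 𝓝[≠] z₀, ‖f z‖ ≤ B :=
  ⟨‖f z₀‖ + 1, eventually_nhdsWithin_of_eventually_nhds ((hf.norm.eventually (gt_mem_nhds (lt_add_one ‖f z₀‖))).mono fun _ h => h.le)⟩

/-- **`hβB` FROM COORDINATE ANALYTICITY**: `Bc z z` is bounded near `z₀` (closed formula `Bc s s′ = κ·Σ qc_j(s) conj qc_l(s′) G_{jl}`). [cite: BernsteinLapid2019, §4 p. 10] -/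
theorem exists_eventually_norm_kernelDiag_le_of_coords {qc : ι → ℂ → ℂ} {z₀ : ℂ} (hqa : ∀ j, AnalyticAt ℂ (qc j) z₀) (κ : ℂ) (G : ι → ι → ℂ) {Bc : ℂ → ℂ → ℂ}
    (hBc : ∀ s s' : ℂ, Bc s s' = κ * ∑ j, ∑ l, qc j s * conj (qc l s') * G j l) : ∃ B : ℝ, ∀ᶠ z in 𝓝[≠] z₀, ‖Bc z z‖ ≤ B := by
  have hcont : ContinuousAt (fun z : ℂ => Bc z z) z₀ := by
    rw [show (fun z : ℂ => Bc z z) = fun z => κ * ∑ j, ∑ l, qc j z * conj (qc l z) * G j l from funext fun z => hBc z z]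
    exact continuousAt_kernelDiag_of_coords hqa κ G
  exact exists_eventually_norm_le_of_continuousAt hcont

/-- **GLOBAL AXIS REALITY ⇒ THE EVENTUAL REALITY LETTER AT A REAL CENTRE**: if `wc` is real at every real `x > 1` off the co-discrete `P`, then `∀ᶠ x in 𝓝[≠] x₀, Im (wc x) = 0` at every real
`x₀ > 1` (the nearby real points other than `x₀` are `> 1` and off `P`). [cite: MoeglinWaldspurger1995, IV.1.10] -/
theorem eventually_im_eq_zero_of_real_offPoles {P : Set ℂ} (hPcd : ∀ z₀ : ℂ, ∀ᶠ s in 𝓝[≠] z₀, s ∉ P) {wc : ℂ → ℂ}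
    (hreal : ∀ x : ℝ, 1 < x → ((x : ℝ) : ℂ) ∉ P → (wc (x : ℂ)).im = 0) {x₀ : ℝ} (hx₀ : 1 < x₀) :
    ∀ᶠ x : ℝ in 𝓝[≠] x₀, (wc (x : ℂ)).im = 0 := by
  have h1 : ∀ᶠ x : ℝ in 𝓝[≠] x₀, 1 < x := eventually_nhdsWithin_of_eventually_nhds (Ioi_mem_nhds hx₀)
  have h2 : Tendsto (fun x : ℝ => (x : ℂ)) (𝓝[≠] x₀) (𝓝[≠] (x₀ : ℂ)) :=
    Complex.continuous_ofReal.continuousWithinAt.tendsto_nhdsWithin fun x hx => by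
      simp only [mem_compl_iff, mem_singleton_iff] at hx ⊢
      exact_mod_cast hx
  filter_upwards [h1, h2.eventually (hPcd (x₀ : ℂ))] with x hx hxP
  exact hreal x hx hxP

end Regular

/-! ## §3 HEAD OF RECORD: `hMSP′` at the named witness family, modulo the two named global letters -/

section OfRecord
variable (L : Type) [Field L] [NumberField L] [IsCMField L] [MeasurableSpace (quasiSplit (↥(maximalRealSubfield L)) L (IsCMField.complexConj L) 3).Adelic] [BorelSpace (quasiSplit (↥(maximalRealSubfield L)) L (IsCMField.complexConj L) 3).Adelic]
  [MeasurableSpace (arch (↥(maximalRealSubfield L)) L (IsCMField.complexConj L) 3 ((StdForm.antidiagonal 3).over L))] [BorelSpace (arch (↥(maximalRealSubfield L)) L (IsCMField.complexConj L) 3 ((StdForm.antidiagonal 3).over L))]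
  [MeasurableSpace (finAdelic (↥(maximalRealSubfield L)) L (IsCMField.complexConj L) 3 ((StdForm.antidiagonal 3).over L))] [BorelSpace (finAdelic (↥(maximalRealSubfield L)) L (IsCMField.complexConj L) 3 ((StdForm.antidiagonal 3).over L))]
  [MeasurableSpace (AdeleRing (𝓞 L) L)ˣ] [BorelSpace (AdeleRing (𝓞 L) L)ˣ]

/-- **`hMSP′` AT THE NAMED WITNESS FAMILY, OF THE TWO COORDINATE LETTERS** — the binder `hMSP′` of ★ `ledgerLetters_of_exports` ∕ the (V) OF RECORD, BYTE FOR BYTE: for every candidate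
`z₀ ∈ midWitnessP` with `1 < Re z₀`, `z₀ ≠ 3∕2`, and every level `T ≥ 1`, an `L²(μ)`-family representing `Λ^T(midWitnessEc z)` a.e. at every `z ∉ midWitnessP` (★ `hE6_midWitness`) and
BOUNDED near `z₀` (★ `hMSP_of_exports_free_at` over §1's (L2) of record and §2's regular data).  Binders: ★ `midWitnessExports_spec`'s VERBATIM; the Maass–Selberg frame extras (`μK`, `νI`, an
idele-class domain `𝓕I`, `ν 𝓕 = 1`, `χ` unitary and trivial on the positive reals); and the TWO NAMED GLOBAL LETTERS — `hqa`: every continued coordinate `midWitnessQc j` is analytic at every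
candidate of `{1 < Re} ∖ {3∕2}` (the scalar half of R7₃); `hreal`: the closed-formula `wc` of record is real at every real `x > 1` off `midWitnessP` (axis reality, self-associate `χ`).
[cite: MoeglinWaldspurger1995, IV.1.10–IV.1.11, IV.3.12 (a)] [cite: BernsteinLapid2019, §4 p. 10] [cite: Rogawski1990, §13.9 p. 229] -/
theorem hMSP'_midWitness_of_coordLetters
    (μ : Measure (quasiSplit (↥(maximalRealSubfield L)) L (IsCMField.complexConj L) 3).automorphicQuotient) [(quasiSplit (↥(maximalRealSubfield L)) L (IsCMField.complexConj L) 3).IsAutomorphicMeasure μ]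
    (νG : Measure (quasiSplit (↥(maximalRealSubfield L)) L (IsCMField.complexConj L) 3).Adelic) [νG.IsHaarMeasure] [νG.IsInvInvariant] [SFinite νG]
    (ν : Measure ↥(adelicUnipotent (↥(maximalRealSubfield L)) L (IsCMField.complexConj L) 3)) [ν.IsHaarMeasure] [ν.IsMulRightInvariant] [ν.IsInvInvariant]
    {𝓕 : Set ↥(adelicUnipotent (↥(maximalRealSubfield L)) L (IsCMField.complexConj L) 3)}
    (h𝓕N : IsFundamentalDomain ↥(rationalUnipotent (↥(maximalRealSubfield L)) L (IsCMField.complexConj L) 3) 𝓕 ν) (h𝓕c : IsCompact (closure 𝓕)) (h𝓕₀ : ν 𝓕 ≠ 0)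
    {β : (quasiSplit (↥(maximalRealSubfield L)) L (IsCMField.complexConj L) 3).Adelic → ℝ≥0∞}
    (hβ : IsCoveringWeight ↥((arithmeticBorel (↥(maximalRealSubfield L)) L (IsCMField.complexConj L) 3).map (quasiSplit (↥(maximalRealSubfield L)) L (IsCMField.complexConj L) 3).arithmeticSubgroup.subtype) β)
    {μZ : Measure (borelQuotient (↥(maximalRealSubfield L)) L (IsCMField.complexConj L) 3)} [SFinite μZ]
    (hμZ : ∀ f : borelQuotient (↥(maximalRealSubfield L)) L (IsCMField.complexConj L) 3 → ℝ≥0∞, Measurable f → ∫⁻ z, f z ∂μZ = ∫⁻ g, β g * f (toBorelQuotient (↥(maximalRealSubfield L)) L (IsCMField.complexConj L) 3 g) ∂νG)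
    -- the M1 family: `φ ∈ V(χ, K, 1)` continuous bounded with `φ ∘ ι_∞ = φ(1)`, and a basis of `V(χʷ, K, 1)` by continuous bounded functions
    {χ : HeckeCharacter L} {K' : Subgroup (quasiSplit (↥(maximalRealSubfield L)) L (IsCMField.complexConj L) 3).Adelic} {ω : ↥K' → ℂ} {φ : (quasiSplit (↥(maximalRealSubfield L)) L (IsCMField.complexConj L) 3).Adelic → ℂ} (hφV : φ ∈ chiSectionSpace χ K' ω) (hφc : Continuous φ) {Mφ : ℝ} (hφM : ∀ x, ‖φ x‖ ≤ Mφ)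
    -- the LEVEL: `K′ ≤ K`, `ι(K_∞) ⊆ K′`, an open compact `U₀` with `ι_f(U₀ ∩ G_f) ⊆ K′` on which `ω = 1`, continuity of the sections; auxiliary Haar measures on `G_∞` (two-sided) and `G(𝔸_f)`
    (hK' : K' ≤ ((standardMaximalCompactGL 3 L).comap (adelicVal (↥(maximalRealSubfield L)) L (IsCMField.complexConj L) 3 ((StdForm.antidiagonal 3).over L)) : Subgroup (quasiSplit (↥(maximalRealSubfield L)) L (IsCMField.complexConj L) 3).Adelic))
    (hKinf : ∀ k : arch (↥(maximalRealSubfield L)) L (IsCMField.complexConj L) 3 ((StdForm.antidiagonal 3).over L), adelicVal (↥(maximalRealSubfield L)) L (IsCMField.complexConj L) 3 ((StdForm.antidiagonal 3).over L) (archToAdelic (↥(maximalRealSubfield L)) L (IsCMField.complexConj L) 3 _ k) ∈ standardMaximalCompactGL 3 L →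
      archToAdelic (↥(maximalRealSubfield L)) L (IsCMField.complexConj L) 3 _ k ∈ K')
    (U₀ : Subgroup (GL (Fin 3) (FiniteAdeleRing (𝓞 L) L))) (hU₀o : IsOpen (U₀ : Set (GL (Fin 3) (FiniteAdeleRing (𝓞 L) L)))) (hU₀c : IsCompact (U₀ : Set (GL (Fin 3) (FiniteAdeleRing (𝓞 L) L))))
    (hU : ∀ b : finAdelic (↥(maximalRealSubfield L)) L (IsCMField.complexConj L) 3 ((StdForm.antidiagonal 3).over L), (b : GL (Fin 3) (FiniteAdeleRing (𝓞 L) L)) ∈ U₀ →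
      ∃ hb : finAdelicToAdelic (↥(maximalRealSubfield L)) L (IsCMField.complexConj L) 3 ((StdForm.antidiagonal 3).over L) b ∈ K', ω ⟨_, hb⟩ = 1)
    (hVc : ∀ φ ∈ chiSectionSpace χ K' ω, Continuous φ)
    (μa : Measure (arch (↥(maximalRealSubfield L)) L (IsCMField.complexConj L) 3 ((StdForm.antidiagonal 3).over L))) [μa.IsHaarMeasure] [μa.IsMulRightInvariant]
    (μf : Measure (finAdelic (↥(maximalRealSubfield L)) L (IsCMField.complexConj L) 3 ((StdForm.antidiagonal 3).over L))) [μf.IsHaarMeasure]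
    {ι' : Type} [Fintype ι'] [DecidableEq ι'] (bV : Module.Basis ι' ℂ ↥(chiSectionSpace (reflectChar (IsCMField.complexConj L) χ) K' ω))
    (hbc : ∀ j, Continuous ((bV j : ↥(chiSectionSpace (reflectChar (IsCMField.complexConj L) χ) K' ω)) : (quasiSplit (↥(maximalRealSubfield L)) L (IsCMField.complexConj L) 3).Adelic → ℂ)) {Mb : ℝ} (hbM : ∀ j x, ‖((bV j : ↥(chiSectionSpace (reflectChar (IsCMField.complexConj L) χ) K' ω)) : (quasiSplit (↥(maximalRealSubfield L)) L (IsCMField.complexConj L) 3).Adelic → ℂ) x‖ ≤ Mb)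
    (h2 : Module.finrank (↥(maximalRealSubfield L)) L = 2) (hc : IsCMField.complexConj L ≠ 1) (hJ : ((StdForm.antidiagonal 3).over L).det ≠ 0)
    (ψ : ↥(TorusDict.torus (IsCMField.complexConj L)) →ₜ* ℂˣ) (hψ : TorusDict.IsAutomorphic (IsCMField.complexConj L) ψ)
    -- the Maass–Selberg frame extras
    (μK : Measure ((standardMaximalCompactGL 3 L).comap (adelicVal (↥(maximalRealSubfield L)) L (IsCMField.complexConj L) 3 ((StdForm.antidiagonal 3).over L)) : Subgroup (quasiSplit (↥(maximalRealSubfield L)) L (IsCMField.complexConj L) 3).Adelic))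
    [μK.IsHaarMeasure]
    (νI : Measure (AdeleRing (𝓞 L) L)ˣ) [νI.IsHaarMeasure]
    {𝓕I : Set (AdeleRing (𝓞 L) L)ˣ} (h𝓕I : IsIdeleClassDomain L 𝓕I) (h𝓕1 : ν 𝓕 = 1)
    (hχ₁ : χ.IsUnitary) (hρ₁ : ∀ r : ℝ≥0ˣ, χ (posRealIdele L r) = 1)
    -- THE TWO NAMED GLOBAL LETTERS: coordinate analyticity at the candidates off `3∕2` (the scalar half), axis reality of the closed-formula `wc` of record
    (hqa : ∀ j (z₀ : ℂ), z₀ ∈ midWitnessP L μ νG ν h𝓕N h𝓕c h𝓕₀ hβ hμZ hφV hφc hφM hK' hKinf U₀ hU₀o hU₀c hU hVc μa μf bV hbc hbM h2 hc hJ ψ hψ → 1 < z₀.re → z₀ ≠ (3 : ℂ) / 2 →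
      AnalyticAt ℂ (midWitnessQc L μ νG ν h𝓕N h𝓕c h𝓕₀ hβ hμZ hφV hφc hφM hK' hKinf U₀ hU₀o hU₀c hU hVc μa μf bV hbc hbM h2 hc hJ ψ hψ j) z₀)
    (hreal : ∀ x : ℝ, 1 < x → ((x : ℝ) : ℂ) ∉ midWitnessP L μ νG ν h𝓕N h𝓕c h𝓕₀ hβ hμZ hφV hφc hφM hK' hKinf U₀ hU₀o hU₀c hU hVc μa μf bV hbc hbM h2 hc hJ ψ hψ →
      (((∑ j, midWitnessQc L μ νG ν h𝓕N h𝓕c h𝓕₀ hβ hμZ hφV hφc hφM hK' hKinf U₀ hU₀o hU₀c hU hVc μa μf bV hbc hbM h2 hc hJ ψ hψ j (x : ℂ) * ∫ k, ((bV j : ↥(chiSectionSpace (reflectChar (IsCMField.complexConj L) χ) K' ω)) : (quasiSplit (↥(maximalRealSubfield L)) L (IsCMField.complexConj L) 3).Adelic → ℂ) (k : (quasiSplit (↥(maximalRealSubfield L)) L (IsCMField.complexConj L) 3).Adelic) * conj (φ (k : (quasiSplit (↥(maximalRealSubfield L)) L (IsCMField.complexConj L) 3).Adelic)) ∂μK)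 *
        ∫ x in {x : (AdeleRing (𝓞 L) L)ˣ | (IdeleClassGroup.ideleNorm L x : ℝ) ≤ 1} ∩ 𝓕I, ((IdeleClassGroup.ideleNorm L x : ℝ) : ℂ) * (((reflectChar (IsCMField.complexConj L) χ x : ℂˣ) : ℂ) * conj ((χ x : ℂˣ) : ℂ)) ∂νI)).im = 0) :
    ∀ z₀ ∈ midWitnessP L μ νG ν h𝓕N h𝓕c h𝓕₀ hβ hμZ hφV hφc hφM hK' hKinf U₀ hU₀o hU₀c hU hVc μa μf bV hbc hbM h2 hc hJ ψ hψ, 1 < z₀.re → z₀ ≠ (3 : ℂ) / 2 → ∀ T : ℝ≥0, 1 ≤ T →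
      ∃ Fam : ℂ → (quasiSplit (↥(maximalRealSubfield L)) L (IsCMField.complexConj L) 3).L2 μ,
        (∀ z : ℂ, z ∉ midWitnessP L μ νG ν h𝓕N h𝓕c h𝓕₀ hβ hμZ hφV hφc hφM hK' hKinf U₀ hU₀o hU₀c hU hVc μa μf bV hbc hbM h2 hc hJ ψ hψ → ((Fam z : (quasiSplit (↥(maximalRealSubfield L)) L (IsCMField.complexConj L) 3).L2 μ) : (quasiSplit (↥(maximalRealSubfield L)) L (IsCMField.complexConj L) 3).automorphicQuotient → ℂ) =ᵐ[μ] (quasiSplit (↥(maximalRealSubfield L)) L (IsCMField.complexConj L) 3).quotFun (truncation ν 𝓕 T (midWitnessEc L μ νG ν h𝓕N h𝓕c h𝓕₀ hβ hμZ hφV hφc hφM hK' hKinf U₀ hU₀o hU₀c hU hVc μa μf bV hbc hbM h2 hc hJ ψ hψ z))) ∧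
        ∃ C : ℝ, ∀ᶠ z in 𝓝[≠] z₀, ‖Fam z‖ ≤ C := by
  intro z₀ hz₀P hz₀ h32 T hT
  -- the spec's clauses: 2 `hqφ`, 5 tube identity, 6 `qc = q` on the tube, 7 closed, 8 co-discrete, 13 `qc` holomorphic off `P`
  obtain ⟨-, hqφ, -, -, hE2, hqcq, hPc, hPcd, -, -, -, -, hqcP, -, -, -⟩ := midWitnessExports_spec L μ νG ν h𝓕N h𝓕c h𝓕₀ hβ hμZ hφV hφc hφM hK' hKinf U₀ hU₀o hU₀c hU hVc μa μf bV hbc hbM h2 hc hJ ψ hψ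
  -- the (E6) family at the named pair (★ p864608)
  obtain ⟨Fam, hFd, hFam⟩ := hE6_midWitness L μ νG ν h𝓕N h𝓕c h𝓕₀ hβ hμZ hφV hφc hφM hK' hKinf U₀ hU₀o hU₀c hU hVc μa μf bV hbc hbM h2 hc hJ ψ hψ hT
  -- (L2) of record (§1) on the basis `bV` of `V(χʷ, K′, ω)` (Gram integrability ★ `integrable_restrict_mul_conj_of_bounded`)
  obtain ⟨wc, Bc, hwc, hwagree, hBc1, hBc2, hBagree, hwcf, hBcf⟩ := exists_scalars_of_coords_global L μK νI 𝓕I ν h𝓕1 χ φ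
    (fun j => ((bV j : ↥(chiSectionSpace (reflectChar (IsCMField.complexConj L) χ) K' ω)) : (quasiSplit (↥(maximalRealSubfield L)) L (IsCMField.complexConj L) 3).Adelic → ℂ))
    hqφ hqcP hqcq hPc (fun j => integrable_restrict_mul_conj_of_bounded L μK (hbc j) hφc (hbM j) hφM)
    (fun j l => integrable_restrict_mul_conj_of_bounded L μK (hbc j) (hbc l) (hbM j) (hbM l))
  -- the M1 section as a pair section with `χ₂ := 1`
  have hφ : IsChiSectionPair χ (1 : ↥(TorusDict.torus (IsCMField.complexConj L)) →ₜ* ℂˣ) φ :=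
    IsChiSection.isChiSectionPair_of_trivial (one_apply_torus (IsCMField.complexConj L)) (isChiSection_of_mem hφV)
  have hχ₂u : ∀ u : ↥(TorusDict.torus (IsCMField.complexConj L)), ‖(((1 : ↥(TorusDict.torus (IsCMField.complexConj L)) →ₜ* ℂˣ) u : ℂˣ) : ℂ)‖ = 1 := fun u => by
    rw [one_apply_torus]; simp
  -- the regular data at `z₀` from the two letters (§2)
  have hqa₀ : ∀ j, AnalyticAt ℂ (midWitnessQc L μ νG ν h𝓕N h𝓕c h𝓕₀ hβ hμZ hφV hφc hφM hK' hKinf U₀ hU₀o hU₀c hU hVc μa μf bV hbc hbM h2 hc hJ ψ hψ j) z₀ := fun j => hqa j z₀ hz₀P hz₀ h32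
  have hwa : AnalyticAt ℂ wc z₀ := analyticAt_of_coords_formula hqa₀ _ _ hwcf
  have hβB : ∃ B : ℝ, ∀ᶠ z in 𝓝[≠] z₀, ‖Bc z z‖ ≤ B := exists_eventually_norm_kernelDiag_le_of_coords hqa₀ _ _ hBcf
  have hreal' : z₀.im = 0 → ∀ᶠ x : ℝ in 𝓝[≠] z₀.re, (wc (x : ℂ)).im = 0 := fun _ =>
    eventually_im_eq_zero_of_real_offPoles hPcd (fun x hx hxP => by rw [hwcf]; exact hreal x hx hxP) hz₀
  exact ⟨Fam, hFam, hMSP_of_exports_free_at L μ νG μK νI h𝓕I ν h𝓕N h𝓕1 h𝓕c hβ hT hχ₁ hρ₁ hχ₂u (isAutomorphic_one (IsCMField.complexConj L)) hφc hφ hφM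
    (midWitnessEc L μ νG ν h𝓕N h𝓕c h𝓕₀ hβ hμZ hφV hφc hφM hK' hKinf U₀ hU₀o hU₀c hU hVc μa μf bV hbc hbM h2 hc hJ ψ hψ) hE2 hPc hPcd Fam hFd hFam hwc hwagree hBc1 hBc2 hBagree hz₀ hwa hreal' hβB⟩

/-- **NON-SELF-ASSOCIATE BLOCKS: `hMSP′` OF ONE LETTER** — if the bracket `[η] = ∫_{‖x‖≤1 ∩ 𝓕_I} ‖x‖·χʷ(x)·conj χ(x) dνI` VANISHES (`χʷ ≠ χ`: orthogonality of idele-class characters), the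
closed-formula `wc` of record is identically `0`, so `hreal` holds trivially and only the coordinate letter `hqa` remains. [cite: MoeglinWaldspurger1995, IV.1.10–IV.1.11] [cite: Rogawski1990, §13.9 p. 229] -/
theorem hMSP'_midWitness_of_coordLetters_of_bracket_eq_zero
    (μ : Measure (quasiSplit (↥(maximalRealSubfield L)) L (IsCMField.complexConj L) 3).automorphicQuotient) [(quasiSplit (↥(maximalRealSubfield L)) L (IsCMField.complexConj L) 3).IsAutomorphicMeasure μ]
    (νG : Measure (quasiSplit (↥(maximalRealSubfield L)) L (IsCMField.complexConj L) 3).Adelic) [νG.IsHaarMeasure] [νG.IsInvInvariant] [SFinite νG]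
    (ν : Measure ↥(adelicUnipotent (↥(maximalRealSubfield L)) L (IsCMField.complexConj L) 3)) [ν.IsHaarMeasure] [ν.IsMulRightInvariant] [ν.IsInvInvariant]
    {𝓕 : Set ↥(adelicUnipotent (↥(maximalRealSubfield L)) L (IsCMField.complexConj L) 3)}
    (h𝓕N : IsFundamentalDomain ↥(rationalUnipotent (↥(maximalRealSubfield L)) L (IsCMField.complexConj L) 3) 𝓕 ν) (h𝓕c : IsCompact (closure 𝓕)) (h𝓕₀ : ν 𝓕 ≠ 0)
    {β : (quasiSplit (↥(maximalRealSubfield L)) L (IsCMField.complexConj L) 3).Adelic → ℝ≥0∞}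
    (hβ : IsCoveringWeight ↥((arithmeticBorel (↥(maximalRealSubfield L)) L (IsCMField.complexConj L) 3).map (quasiSplit (↥(maximalRealSubfield L)) L (IsCMField.complexConj L) 3).arithmeticSubgroup.subtype) β)
    {μZ : Measure (borelQuotient (↥(maximalRealSubfield L)) L (IsCMField.complexConj L) 3)} [SFinite μZ]
    (hμZ : ∀ f : borelQuotient (↥(maximalRealSubfield L)) L (IsCMField.complexConj L) 3 → ℝ≥0∞, Measurable f → ∫⁻ z, f z ∂μZ = ∫⁻ g, β g * f (toBorelQuotient (↥(maximalRealSubfield L)) L (IsCMField.complexConj L) 3 g) ∂νG)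
    -- the M1 family: `φ ∈ V(χ, K, 1)` continuous bounded with `φ ∘ ι_∞ = φ(1)`, and a basis of `V(χʷ, K, 1)` by continuous bounded functions
    {χ : HeckeCharacter L} {K' : Subgroup (quasiSplit (↥(maximalRealSubfield L)) L (IsCMField.complexConj L) 3).Adelic} {ω : ↥K' → ℂ} {φ : (quasiSplit (↥(maximalRealSubfield L)) L (IsCMField.complexConj L) 3).Adelic → ℂ} (hφV : φ ∈ chiSectionSpace χ K' ω) (hφc : Continuous φ) {Mφ : ℝ} (hφM : ∀ x, ‖φ x‖ ≤ Mφ)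
    -- the LEVEL: `K′ ≤ K`, `ι(K_∞) ⊆ K′`, an open compact `U₀` with `ι_f(U₀ ∩ G_f) ⊆ K′` on which `ω = 1`, continuity of the sections; auxiliary Haar measures on `G_∞` (two-sided) and `G(𝔸_f)`
    (hK' : K' ≤ ((standardMaximalCompactGL 3 L).comap (adelicVal (↥(maximalRealSubfield L)) L (IsCMField.complexConj L) 3 ((StdForm.antidiagonal 3).over L)) : Subgroup (quasiSplit (↥(maximalRealSubfield L)) L (IsCMField.complexConj L) 3).Adelic))
    (hKinf : ∀ k : arch (↥(maximalRealSubfield L)) L (IsCMField.complexConj L) 3 ((StdForm.antidiagonal 3).over L), adelicVal (↥(maximalRealSubfield L)) L (IsCMField.complexConj L) 3 ((StdForm.antidiagonal 3).over L) (archToAdelic (↥(maximalRealSubfield L)) L (IsCMField.complexConj L) 3 _ k) ∈ standardMaximalCompactGL 3 L →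
      archToAdelic (↥(maximalRealSubfield L)) L (IsCMField.complexConj L) 3 _ k ∈ K')
    (U₀ : Subgroup (GL (Fin 3) (FiniteAdeleRing (𝓞 L) L))) (hU₀o : IsOpen (U₀ : Set (GL (Fin 3) (FiniteAdeleRing (𝓞 L) L)))) (hU₀c : IsCompact (U₀ : Set (GL (Fin 3) (FiniteAdeleRing (𝓞 L) L))))
    (hU : ∀ b : finAdelic (↥(maximalRealSubfield L)) L (IsCMField.complexConj L) 3 ((StdForm.antidiagonal 3).over L), (b : GL (Fin 3) (FiniteAdeleRing (𝓞 L) L)) ∈ U₀ →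
      ∃ hb : finAdelicToAdelic (↥(maximalRealSubfield L)) L (IsCMField.complexConj L) 3 ((StdForm.antidiagonal 3).over L) b ∈ K', ω ⟨_, hb⟩ = 1)
    (hVc : ∀ φ ∈ chiSectionSpace χ K' ω, Continuous φ)
    (μa : Measure (arch (↥(maximalRealSubfield L)) L (IsCMField.complexConj L) 3 ((StdForm.antidiagonal 3).over L))) [μa.IsHaarMeasure] [μa.IsMulRightInvariant]
    (μf : Measure (finAdelic (↥(maximalRealSubfield L)) L (IsCMField.complexConj L) 3 ((StdForm.antidiagonal 3).over L))) [μf.IsHaarMeasure]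
    {ι' : Type} [Fintype ι'] [DecidableEq ι'] (bV : Module.Basis ι' ℂ ↥(chiSectionSpace (reflectChar (IsCMField.complexConj L) χ) K' ω))
    (hbc : ∀ j, Continuous ((bV j : ↥(chiSectionSpace (reflectChar (IsCMField.complexConj L) χ) K' ω)) : (quasiSplit (↥(maximalRealSubfield L)) L (IsCMField.complexConj L) 3).Adelic → ℂ)) {Mb : ℝ} (hbM : ∀ j x, ‖((bV j : ↥(chiSectionSpace (reflectChar (IsCMField.complexConj L) χ) K' ω)) : (quasiSplit (↥(maximalRealSubfield L)) L (IsCMField.complexConj L) 3).Adelic → ℂ) x‖ ≤ Mb)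
    (h2 : Module.finrank (↥(maximalRealSubfield L)) L = 2) (hc : IsCMField.complexConj L ≠ 1) (hJ : ((StdForm.antidiagonal 3).over L).det ≠ 0)
    (ψ : ↥(TorusDict.torus (IsCMField.complexConj L)) →ₜ* ℂˣ) (hψ : TorusDict.IsAutomorphic (IsCMField.complexConj L) ψ)
    (μK : Measure ((standardMaximalCompactGL 3 L).comap (adelicVal (↥(maximalRealSubfield L)) L (IsCMField.complexConj L) 3 ((StdForm.antidiagonal 3).over L)) : Subgroup (quasiSplit (↥(maximalRealSubfield L)) L (IsCMField.complexConj L) 3).Adelic))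
    [μK.IsHaarMeasure]
    (νI : Measure (AdeleRing (𝓞 L) L)ˣ) [νI.IsHaarMeasure]
    {𝓕I : Set (AdeleRing (𝓞 L) L)ˣ} (h𝓕I : IsIdeleClassDomain L 𝓕I) (h𝓕1 : ν 𝓕 = 1)
    (hχ₁ : χ.IsUnitary) (hρ₁ : ∀ r : ℝ≥0ˣ, χ (posRealIdele L r) = 1)
    (hqa : ∀ j (z₀ : ℂ), z₀ ∈ midWitnessP L μ νG ν h𝓕N h𝓕c h𝓕₀ hβ hμZ hφV hφc hφM hK' hKinf U₀ hU₀o hU₀c hU hVc μa μf bV hbc hbM h2 hc hJ ψ hψ → 1 < z₀.re → z₀ ≠ (3 : ℂ) / 2 →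
      AnalyticAt ℂ (midWitnessQc L μ νG ν h𝓕N h𝓕c h𝓕₀ hβ hμZ hφV hφc hφM hK' hKinf U₀ hU₀o hU₀c hU hVc μa μf bV hbc hbM h2 hc hJ ψ hψ j) z₀)
    (hη : (∫ x in {x : (AdeleRing (𝓞 L) L)ˣ | (IdeleClassGroup.ideleNorm L x : ℝ) ≤ 1} ∩ 𝓕I, ((IdeleClassGroup.ideleNorm L x : ℝ) : ℂ) * (((reflectChar (IsCMField.complexConj L) χ x : ℂˣ) : ℂ) * conj ((χ x : ℂˣ) : ℂ)) ∂νI) = 0) :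
    ∀ z₀ ∈ midWitnessP L μ νG ν h𝓕N h𝓕c h𝓕₀ hβ hμZ hφV hφc hφM hK' hKinf U₀ hU₀o hU₀c hU hVc μa μf bV hbc hbM h2 hc hJ ψ hψ, 1 < z₀.re → z₀ ≠ (3 : ℂ) / 2 → ∀ T : ℝ≥0, 1 ≤ T →
      ∃ Fam : ℂ → (quasiSplit (↥(maximalRealSubfield L)) L (IsCMField.complexConj L) 3).L2 μ,
        (∀ z : ℂ, z ∉ midWitnessP L μ νG ν h𝓕N h𝓕c h𝓕₀ hβ hμZ hφV hφc hφM hK' hKinf U₀ hU₀o hU₀c hU hVc μa μf bV hbc hbM h2 hc hJ ψ hψ → ((Fam z : (quasiSplit (↥(maximalRealSubfield L)) L (IsCMField.complexConj L) 3).L2 μ) : (quasiSplit (↥(maximalRealSubfield L)) L (IsCMField.complexConj L) 3).automorphicQuotient → ℂ) =ᵐ[μ] (quasiSplit (↥(maximalRealSubfield L)) L (IsCMField.complexConj L) 3).quotFun (truncation ν 𝓕 T (midWitnessEc L μ νG ν h𝓕N h𝓕c h𝓕₀ hβ hμZ hφV hφc hφM hK' hKinf U₀ hU₀o hU₀c hU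 hVc μa μf bV hbc hbM h2 hc hJ ψ hψ z))) ∧
        ∃ C : ℝ, ∀ᶠ z in 𝓝[≠] z₀, ‖Fam z‖ ≤ C :=
  hMSP'_midWitness_of_coordLetters L μ νG ν h𝓕N h𝓕c h𝓕₀ hβ hμZ hφV hφc hφM hK' hKinf U₀ hU₀o hU₀c hU hVc μa μf bV hbc hbM h2 hc hJ ψ hψ μK νI h𝓕I h𝓕1 hχ₁ hρ₁ hqa fun x _ _ => by
    rw [hη, mul_zero, Complex.zero_im]

end OfRecord

end Summit.HodgeConjecture.HodgeConjecture.Cruxes.H413.K2E1ChiMaassSelbergOnAxisScalarsOfRecordCMThree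

end
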